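import Mathlib.MeasureTheory.Measure.Tight
import Mathlib.Topology.UniformSpace.Ascoli
import Mathlib.Topology.MetricSpace.Equicontinuity
import Mathlib.Topology.MetricSpace.Thickening
import Mathlib.Analysis.SpecificLimits.Basic
import HarnessLib

/-!
# Tightness in the path space `C([0, ∞), E)` from moduli of continuity (Arzelà–Ascoli)

For a proper metric space `E` (e.g. `ℝ`, `ℂ`; the chain lemmas only need a pseudo-metric) we
prove the standard tightness criterion
for random continuous paths `Xᵢ : Ωᵢ → C(ℝ≥0, E)` (compact-open topology = locally uniform
convergence), Billingsley, *Convergence of Probability Measures* (2nd ed. 1999), Thm. 7.3 (for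
`C[0, 1]`; the `C[0, ∞)` version restricts to every `[0, k+1]`, cf. Karatzas–Shreve (1991),
Thm. 2.4.10, which is the reference "[17]" in [LSW04] p. 981):

* `Literature.Probability.Process.isCompact_modulusSet` — **Arzelà–Ascoli**: the paths `x` with
  `x(0)` in a fixed compact set and prescribed moduli of continuity on every `[0, k+1]` form a
  compact subset of `C(ℝ≥0, E)` (Mathlib `ArzelaAscoli.isCompact_closure_of_isClosedEmbedding`);
* `Literature.Probability.Process.isTightMeasureSet_range_map_of_modulus` — if the laws of the
  `Xᵢ(0)` are uniformly tight and for every horizon `T`, every `ε > 0` and `η > 0` there is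
  `δ > 0` with `Pᵢ[∃ s, t ≤ T, |s - t| ≤ δ, dist(Xᵢ(s), Xᵢ(t)) ≥ ε] ≤ η` for all `i`, then the
  laws of the `Xᵢ` form a tight set of measures on `C(ℝ≥0, E)`.

This is the step "the family of laws of `γ̂` is tight, because of Proposition 4.5 and the
Arzelà–Ascoli theorem" of Lawler–Schramm–Werner (2004), proof of Thm. 4.7, p. 981, isolated as a
deterministic/measure-theoretic statement (hypothesis (ii) of
`RandomPlanarGeometry.hasSLETrace_of_tendstoInDistribution`, file `SLETraceApproximation`; fed
through `RandomPlanarGeometry.isTightMeasureSet_of_prop45_shape`, file `SLETraceEightAssembly`). No measurability of the `Xᵢ` is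
assumed (a non-measurable `Xᵢ` has the junk law `0`; events are measured by outer measure).

## References

* P. Billingsley, *Convergence of Probability Measures*, 2nd ed. (1999), Thm. 7.3.
* I. Karatzas, S. Shreve, *Brownian Motion and Stochastic Calculus*, 2nd ed. (1991), Thm. 2.4.10.
* G. F. Lawler, O. Schramm, W. Werner, Ann. Probab. 32 (2004), proof of Thm. 4.7 (p. 981).
-/

noncomputable section

open Set Filter Topology Metric MeasureTheory
open scoped NNReal ENNReal

namespace Literature.Probability.Process

section Chain

variable {E : Type*} [PseudoMetricSpace E]

/-! ### Chains: a modulus of continuity on `[0, T]` bounds the displacement from time `0` -/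

/-- If `dist (x s) (x t) ≤ c` whenever `s, t ≤ T` and `dist s t ≤ δ` (`δ > 0`), then for
`t ≤ T` with `t ≤ (n + 1) δ` one has `dist (x 0) (x t) ≤ (n + 1) c` (chain through the points
`t - δ, t - 2δ, …`). [folklore] -/
theorem dist_apply_zero_le_of_modulus (x : ℝ≥0 → E) {T δ c : ℝ} (hδ : 0 < δ)
    (h : ∀ s t : ℝ≥0, (s : ℝ) ≤ T → (t : ℝ) ≤ T → dist s t ≤ δ → dist (x s) (x t) ≤ c)
    (n : ℕ) : ∀ t : ℝ≥0, (t : ℝ) ≤ T → (t : ℝ) ≤ (n + 1) * δ → dist (x 0) (x t) ≤ (n + 1) * c := by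
  induction n with
  | zero =>
    intro t htT htδ
    have h0T : ((0 : ℝ≥0) : ℝ) ≤ T := le_trans t.coe_nonneg htT
    have hdist : dist (0 : ℝ≥0) t ≤ δ := by
      rw [NNReal.dist_eq, NNReal.coe_zero, zero_sub, abs_neg, abs_of_nonneg t.coe_nonneg]
      simpa using htδ
    simpa using h 0 t h0T htT hdist
  | succ n ih =>
    intro t htT htδ
    by_cases hle : (t : ℝ) ≤ (n + 1) * δ
    · refine (ih t htT hle).trans ?_
      have hc : 0 ≤ c := le_trans dist_nonneg (h 0 0 (le_trans t.coe_nonneg htT)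
        (le_trans t.coe_nonneg htT) (by simp [hδ.le]))
      push_cast
      nlinarith
    · rw [not_le] at hle
      have htδ' : δ ≤ (t : ℝ) := by nlinarith [hδ]
      set t' : ℝ≥0 := ⟨(t : ℝ) - δ, by linarith⟩ with ht'
      have ht'c : (t' : ℝ) = t - δ := rfl
      have h1 : dist (x 0) (x t') ≤ (n + 1) * c :=
        ih t' (by rw [ht'c]; linarith) (by rw [ht'c]; push_cast at htδ ⊢; linarith)
      have h2 : dist (x t') (x t) ≤ c :=
        h t' t (by rw [ht'c]; linarith) htT (by rw [NNReal.dist_eq, ht'c]; rw [abs_of_nonpos (by linarith)]; linarith)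
      calc dist (x 0) (x t) ≤ dist (x 0) (x t') + dist (x t') (x t) := dist_triangle _ _ _
        _ ≤ (n + 1) * c + c := add_le_add h1 h2
        _ = ((n + 1 : ℕ) + 1) * c := by push_cast; ring

/-- Displacement bound from a modulus of continuity: under the hypothesis of
`dist_apply_zero_le_of_modulus`, `dist (x 0) (x t) ≤ (t/δ + 1) c` hence `≤ (T/δ + 1) c` for
`t ≤ T` (`c ≥ 0`). [folklore] -/
theorem dist_apply_zero_le_of_modulus' (x : ℝ≥0 → E) {T δ c : ℝ} (hδ : 0 < δ) (hc : 0 ≤ c)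
    (h : ∀ s t : ℝ≥0, (s : ℝ) ≤ T → (t : ℝ) ≤ T → dist s t ≤ δ → dist (x s) (x t) ≤ c)
    {t : ℝ≥0} (ht : (t : ℝ) ≤ T) : dist (x 0) (x t) ≤ (T / δ + 1) * c := by
  have hT : 0 ≤ T := le_trans t.coe_nonneg ht
  set n : ℕ := ⌊(t : ℝ) / δ⌋₊ with hn
  have h1 : (t : ℝ) ≤ (n + 1) * δ := by
    have := (Nat.lt_floor_add_one ((t : ℝ) / δ)).le
    rw [div_le_iff₀ hδ] at this
    exact this
  refine (dist_apply_zero_le_of_modulus x hδ h n t ht h1).trans ?_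
  have h2 : (n : ℝ) ≤ T / δ := (Nat.floor_le (by positivity)).trans (by gcongr)
  nlinarith

end Chain

section Compact

variable {E : Type*} [MetricSpace E]

/-! ### Arzelà–Ascoli: compact sets of paths with prescribed moduli -/

/-- The set of paths `x ∈ C(ℝ≥0, E)` starting in `K₀` and admitting, on each `[0, k+1]`, the
modulus "`dist s t ≤ δ k ⇒ dist (x s) (x t) ≤ 1/(k+1)`". [folklore] -/
def modulusSet (K₀ : Set E) (δ : ℕ → ℝ) : Set C(ℝ≥0, E) :=
  {x | x 0 ∈ K₀ ∧ ∀ k : ℕ, ∀ s t : ℝ≥0, (s : ℝ) ≤ k + 1 → (t : ℝ) ≤ k + 1 → dist s t ≤ δ k →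
    dist (x s) (x t) ≤ 1 / ((k : ℝ) + 1)}

/-- `modulusSet K₀ δ` is closed (evaluations are continuous). [folklore] -/
theorem isClosed_modulusSet {K₀ : Set E} (hK₀ : IsClosed K₀) (δ : ℕ → ℝ) :
    IsClosed (modulusSet K₀ δ) := by
  have h1 : IsClosed {x : C(ℝ≥0, E) | x 0 ∈ K₀} := hK₀.preimage (continuous_eval_const 0)
  have h2 : ∀ (k : ℕ) (s t : ℝ≥0), IsClosed {x : C(ℝ≥0, E) | (s : ℝ) ≤ k + 1 → (t : ℝ) ≤ k + 1 →
      dist s t ≤ δ k → dist (x s) (x t) ≤ 1 / ((k : ℝ) + 1)} := by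
    intro k s t
    by_cases hs : (s : ℝ) ≤ k + 1
    · by_cases ht : (t : ℝ) ≤ k + 1
      · by_cases hst : dist s t ≤ δ k
        · simp only [hs, ht, hst, forall_const]
          exact isClosed_le ((continuous_eval_const s).dist (continuous_eval_const t))
            continuous_const
        · simp [hst]
      · simp [ht]
    · simp [hs]
  have : modulusSet K₀ δ = {x : C(ℝ≥0, E) | x 0 ∈ K₀} ∩ ⋂ k : ℕ, ⋂ s : ℝ≥0, ⋂ t : ℝ≥0,
      {x : C(ℝ≥0, E) | (s : ℝ) ≤ k + 1 → (t : ℝ) ≤ k + 1 → dist s t ≤ δ k →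
        dist (x s) (x t) ≤ 1 / ((k : ℝ) + 1)} := by
    ext x
    simp only [modulusSet, mem_setOf_eq, mem_inter_iff, mem_iInter]
  rw [this]
  exact h1.inter (isClosed_iInter fun k ↦ isClosed_iInter fun s ↦ isClosed_iInter fun t ↦ h2 k s t)

/-- **Arzelà–Ascoli for path space**: for `K₀ ⊆ E` compact, `E` proper and `δ k > 0`, the set
`modulusSet K₀ δ` is compact in `C(ℝ≥0, E)` — it is closed, equicontinuous (on `[0, k+1]` the
modulus `δ k` serves every `ε > 1/(k+1)`), and pointwise bounded (chain from `x 0 ∈ K₀`,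
`dist_apply_zero_le_of_modulus'`, so `x t` lies in a compact thickening of `K₀`); Mathlib's
`ArzelaAscoli.isCompact_closure_of_isClosedEmbedding` for `C(ℝ≥0, E) ↪ (ℝ≥0 →ᵤ[compacts] E)`.
Billingsley (1999), Thm. 7.2 (Arzelà–Ascoli characterisation of relative compactness in `C`).
[cite: Billingsley1999, Thm. 7.2] -/
theorem isCompact_modulusSet [ProperSpace E] {K₀ : Set E} (hK₀ : IsCompact K₀) {δ : ℕ → ℝ}
    (hδ : ∀ k, 0 < δ k) : IsCompact (modulusSet K₀ δ) := by
  -- `C(ℝ≥0, E) → (ℝ≥0 →ᵤ[compacts] E)` is a closed embedding (`ℝ≥0` is locally compact)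
  have hce : IsClosedEmbedding
      (UniformOnFun.ofFun {K : Set ℝ≥0 | IsCompact K} ∘ fun f : C(ℝ≥0, E) ↦ (⇑f : ℝ≥0 → E)) := by
    refine ⟨ContinuousMap.isUniformEmbedding_toUniformOnFunIsCompact.isEmbedding, ?_⟩
    change IsClosed (range (ContinuousMap.toUniformOnFunIsCompact : C(ℝ≥0, E) → _))
    rw [ContinuousMap.range_toUniformOnFunIsCompact]
    exact UniformOnFun.isClosed_setOf_continuous CompactlyCoherentSpace.isCoherentWith
  -- equicontinuity
  have heq : Equicontinuous ((fun f : C(ℝ≥0, E) ↦ (⇑f : ℝ≥0 → E)) ∘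
      ((↑) : modulusSet K₀ δ → C(ℝ≥0, E))) := by
    intro t₀
    rw [Metric.equicontinuousAt_iff]
    intro ε hε
    obtain ⟨k, hk, hkε⟩ : ∃ k : ℕ, (t₀ : ℝ) + 1 ≤ k + 1 ∧ 1 / ((k : ℝ) + 1) < ε := by
      obtain ⟨k₁, hk₁⟩ := exists_nat_ge (t₀ : ℝ)
      obtain ⟨k₂, hk₂⟩ := exists_nat_one_div_lt hε
      refine ⟨max k₁ k₂, ?_, lt_of_le_of_lt ?_ hk₂⟩
      · have : (k₁ : ℝ) ≤ max k₁ k₂ := by exact_mod_cast le_max_left k₁ k₂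
        linarith
      · gcongr
        exact_mod_cast le_max_right k₁ k₂
    refine ⟨min (δ k) 1, lt_min (hδ k) one_pos, fun t ht ↦ ?_⟩
    rintro ⟨x, hx⟩
    change dist (x t₀) (x t) < ε
    have ht1 : dist t t₀ < 1 := lt_of_lt_of_le ht (min_le_right _ _)
    have htk : (t : ℝ) ≤ k + 1 := by
      rw [NNReal.dist_eq] at ht1
      linarith [(abs_lt.1 ht1).2]
    have ht₀k : (t₀ : ℝ) ≤ k + 1 := by linarith
    refine lt_of_le_of_lt (hx.2 k t₀ t ht₀k htk ?_) hkε
    rw [dist_comm]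
    exact (lt_of_lt_of_le ht (min_le_left _ _)).le
  -- pointwise boundedness: `x t` lies in a compact thickening of `K₀`
  have hpt : ∀ K ∈ {K : Set ℝ≥0 | IsCompact K}, ∀ t ∈ K, ∃ Q : Set E, IsCompact Q ∧
      ∀ x ∈ modulusSet K₀ δ, (fun f : C(ℝ≥0, E) ↦ (⇑f : ℝ≥0 → E)) x t ∈ Q := by
    intro K _ t _
    obtain ⟨k, hk⟩ := exists_nat_ge (t : ℝ)
    set R : ℝ := (((k : ℝ) + 1) / δ k + 1) * (1 / ((k : ℝ) + 1)) with hR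
    refine ⟨cthickening R K₀, hK₀.cthickening, fun x hx ↦ ?_⟩
    change x t ∈ cthickening R K₀
    refine mem_cthickening_of_dist_le (x t) (x 0) R K₀ hx.1 ?_
    rw [dist_comm]
    exact dist_apply_zero_le_of_modulus' x (hδ k) (by positivity) (hx.2 k) (by linarith)
  have hcpt : IsCompact (closure (modulusSet K₀ δ)) :=
    ArzelaAscoli.isCompact_closure_of_isClosedEmbedding (F := fun f : C(ℝ≥0, E) ↦ (⇑f : ℝ≥0 → E))
      (fun K hK ↦ hK) hce (fun K _ ↦ heq.equicontinuousOn K) hpt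
  rwa [(isClosed_modulusSet hK₀.isClosed δ).closure_eq] at hcpt

/-! ### The tightness criterion -/

/-- `∑ₖ ε (1/2)^(k+2) = ε/2` in `ℝ≥0∞`. [folklore] -/
theorem tsum_mul_inv_two_pow_add_two (ε : ℝ≥0∞) :
    ∑' k : ℕ, ε * (2⁻¹ : ℝ≥0∞) ^ (k + 2) = ε / 2 := by
  have h1 : ∀ k : ℕ, ε * (2⁻¹ : ℝ≥0∞) ^ (k + 2) = ε * (2⁻¹) ^ 2 * (2⁻¹ : ℝ≥0∞) ^ k := fun k ↦ by
    rw [pow_add, mul_comm ((2⁻¹ : ℝ≥0∞) ^ k), mul_assoc]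
  have h2 : (2⁻¹ : ℝ≥0∞) ^ 2 * 2 = 2⁻¹ := by
    rw [sq, mul_assoc, ENNReal.inv_mul_cancel two_ne_zero ENNReal.ofNat_ne_top, mul_one]
  calc ∑' k : ℕ, ε * (2⁻¹ : ℝ≥0∞) ^ (k + 2)
      = ∑' k : ℕ, ε * (2⁻¹) ^ 2 * (2⁻¹ : ℝ≥0∞) ^ k := tsum_congr h1
    _ = ε * (2⁻¹) ^ 2 * (1 - 2⁻¹)⁻¹ := by rw [ENNReal.tsum_mul_left, ENNReal.tsum_geometric]
    _ = ε / 2 := by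
        rw [ENNReal.one_sub_inv_two, inv_inv, mul_assoc, h2, ENNReal.div_eq_inv_mul, mul_comm]

/-- **Tightness in `C([0, ∞), E)` from moduli of continuity** (Billingsley (1999), Thm. 7.3;
Karatzas–Shreve (1991), Thm. 2.4.10). Let `Xᵢ : Ωᵢ → C(ℝ≥0, E)` be random paths under measures
`Pᵢ`, `E` proper. Assume (i) for every `η > 0` there is a compact `K₀ ⊆ E` with
`Pᵢ[Xᵢ(0) ∉ K₀] ≤ η` for all `i`; (ii) for every horizon `T`, every `ε > 0` and `η > 0` there is
`δ > 0` with `Pᵢ[∃ s, t ≤ T, dist s t ≤ δ, ε ≤ dist (Xᵢ s) (Xᵢ t)] ≤ η` for all `i`. Then the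
laws `Pᵢ ∘ Xᵢ⁻¹` form a tight set of measures on `C(ℝ≥0, E)`: the compact set is
`modulusSet K₀ δ` (`isCompact_modulusSet`) with `δ k` chosen for `T = k+1`, `ε = 1/(k+1)`,
`η = η₀ 2^{-k-2}`. This is the tightness step of [LSW04], proof of Thm. 4.7 (p. 981).
[cite: Billingsley1999, Thm. 7.3] -/
theorem isTightMeasureSet_range_map_of_modulus [ProperSpace E]
    [MeasurableSpace C(ℝ≥0, E)] [OpensMeasurableSpace C(ℝ≥0, E)]
    {ι : Type*} {Ω : ι → Type*} [∀ i, MeasurableSpace (Ω i)] {P : ∀ i, Measure (Ω i)}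
    {X : ∀ i, Ω i → C(ℝ≥0, E)}
    (h0 : ∀ η : ℝ≥0∞, 0 < η → ∃ K₀ : Set E, IsCompact K₀ ∧ ∀ i, P i {ω | X i ω 0 ∉ K₀} ≤ η)
    (hmod : ∀ (T ε : ℝ), 0 < ε → ∀ η : ℝ≥0∞, 0 < η → ∃ δ : ℝ, 0 < δ ∧ ∀ i,
      P i {ω | ∃ s t : ℝ≥0, (s : ℝ) ≤ T ∧ (t : ℝ) ≤ T ∧ dist s t ≤ δ ∧
        ε ≤ dist (X i ω s) (X i ω t)} ≤ η) :
    IsTightMeasureSet (Set.range fun i ↦ (P i).map (X i)) := by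
  rw [isTightMeasureSet_iff_exists_isCompact_measure_compl_le]
  intro ε hε
  rcases eq_or_ne ε ⊤ with rfl | hεtop
  · exact ⟨∅, isCompact_empty, fun μ _ ↦ le_top⟩
  have hε0 : ε ≠ 0 := hε.ne'
  -- the compact set
  obtain ⟨K₀, hK₀, hK₀P⟩ := h0 (ε / 2) (ENNReal.half_pos hε0)
  have hη : ∀ k : ℕ, 0 < ε * (2⁻¹ : ℝ≥0∞) ^ (k + 2) := fun k ↦
    ENNReal.mul_pos hε0 (pow_ne_zero _ (ENNReal.inv_ne_zero.2 ENNReal.ofNat_ne_top))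
  choose δ hδ hδP using fun k : ℕ ↦ hmod ((k : ℝ) + 1) (1 / ((k : ℝ) + 1)) (by positivity) _ (hη k)
  refine ⟨modulusSet K₀ δ, isCompact_modulusSet hK₀ hδ, ?_⟩
  rintro _ ⟨i, rfl⟩
  change ((P i).map (X i)) (modulusSet K₀ δ)ᶜ ≤ ε
  by_cases hX : AEMeasurable (X i) (P i)
  swap
  · rw [Measure.map_of_not_aemeasurable hX]
    exact bot_le
  rw [Measure.map_apply_of_aemeasurable hX (isClosed_modulusSet hK₀.isClosed δ).measurableSet.compl]
  -- decomposition of the bad event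
  have hsub : X i ⁻¹' (modulusSet K₀ δ)ᶜ ⊆ {ω | X i ω 0 ∉ K₀} ∪ ⋃ k : ℕ,
      {ω | ∃ s t : ℝ≥0, (s : ℝ) ≤ (k : ℝ) + 1 ∧ (t : ℝ) ≤ (k : ℝ) + 1 ∧ dist s t ≤ δ k ∧
        1 / ((k : ℝ) + 1) ≤ dist (X i ω s) (X i ω t)} := by
    intro ω hω
    simp only [mem_preimage, mem_compl_iff, modulusSet, mem_setOf_eq, not_and_or, not_forall,
      not_le] at hω
    rcases hω with h | ⟨k, s, t, hs, ht, hst, hlt⟩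
    · exact Or.inl h
    · exact Or.inr (mem_iUnion.2 ⟨k, s, t, hs, ht, hst, hlt.le⟩)
  calc P i (X i ⁻¹' (modulusSet K₀ δ)ᶜ)
      ≤ P i {ω | X i ω 0 ∉ K₀} + P i (⋃ k : ℕ, {ω | ∃ s t : ℝ≥0, (s : ℝ) ≤ (k : ℝ) + 1 ∧
          (t : ℝ) ≤ (k : ℝ) + 1 ∧ dist s t ≤ δ k ∧ 1 / ((k : ℝ) + 1) ≤ dist (X i ω s) (X i ω t)}) :=
        (measure_mono hsub).trans (measure_union_le _ _)
    _ ≤ ε / 2 + ∑' k : ℕ, ε * (2⁻¹ : ℝ≥0∞) ^ (k + 2) := by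
        gcongr
        · exact hK₀P i
        · exact (measure_iUnion_le _).trans (ENNReal.tsum_le_tsum fun k ↦ hδP k i)
    _ = ε := by rw [tsum_mul_inv_two_pow_add_two, ENNReal.add_halves]

end Compact

end Literature.Probability.Process
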